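import Literature.NumberTheory.EllipticCurves.GeomReductionFrobeniusProofs
import Literature.NumberTheory.EllipticCurves.BSDConductorProofs
import HarnessLib

/-!
# The Kummer congruence at an arithmetic Frobenius: `σ γ = ζ₃ γ`, `γ³ = x` ⟹ `x^{(ℓ−1)/3} ≢ 1 (mod 𝔓)` — dictionary (D4) of the split prime-conductor
# Chebotarev–Kummer supply (c′)
# (cell `bsd-stepL`, seat `bsd-stepL-corner3-p2` g14 = lane B, LINE OWNER of crux 21420 `CornerAtThreeW`; `--supports stmt-BirchSwinnertonDyer-21420 --as helper`)

WHY. In the formalization plan of (c′) (lane B g14 memo CORNER3-G14 §6–§7) the Chebotarev prime `ℓ₀ ≡ 1 (mod 3)` comes with an arithmetic Frobenius `σ` at a prime `𝔓 ∣ ℓ₀`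
of `ℤ̄` acting on a cube root `γ` of `x = β β̄²` by a primitive cube root of unity; dictionary (D3) (`…RingClassThetaOrder`, p652524) then wants «`β^{(ℓ₀−1)/3}` is not
rational mod `ℓ₀`», which follows (by conjugation) from **`x^{(ℓ₀−1)/3} ≢ 1 (mod 𝔓)`**. THIS FILE proves that congruence statement inside `ℤ̄ = absIntegers (𝓞 ℚ) ℚ`:
`pow_sub_one_not_mem_of_frob_smul_eq_mul` — for a prime `ℓ = 3k + 1 ≠ 3`, a place `v ∣ ℓ` of `ℚ`, `𝔓 ∈ v.primesAbove`, `σ` an arithmetic Frobenius at `𝔓`, and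
`x, γ, ζ ∈ ℤ̄` with `γ³ = x ∉ 𝔓`, `ζ² + ζ + 1 = 0`, `σ • γ = ζ γ`: then `x^k − 1 ∉ 𝔓`. Proof: `σγ ≡ γ^ℓ = x^k γ (mod 𝔓)` (`smul_sub_pow_mem_of_isArithFrobAt`), so
`(ζ − x^k) γ ∈ 𝔓`, `γ ∉ 𝔓`, hence `ζ ≡ x^k`; if also `x^k ≡ 1` then `ζ − 1 ∈ 𝔓`, and `(ζ − 1)(ζ + 2) = −3` puts `3 ∈ 𝔓 ∋ ℓ`, so `1 ∈ 𝔓` — absurd.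
HONEST FRAMING: THEOREMS ONLY (no definition, no named fact, no `sorry`); elementary algebraic number theory in `ℤ̄`; nothing about any curve or CM point; no stub ∕ item
closes; 21420 OPEN; no census label moves (T7); BSD is proved for no curve.
References (locators only): [cite: SerreLocalFields1979, Ch. I §8 (Frobenius substitution)] [cite: Cox2013, §5.B and §8.B (cubic residues via Frobenius on cube roots)].
presearch: in-tree (`GeomReductionFrobeniusProofs.smul_sub_pow_mem_of_isArithFrobAt`). Axioms: `propext`, `Classical.choice`, `Quot.sound`.
-/

set_option autoImplicit false
set_option linter.dupNamespace false

noncomputable section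

open scoped Classical NumberField Pointwise
open IsDedekindDomain Field

namespace Summit.BirchSwinnertonDyer.BirchSwinnertonDyer.Theorems.FrobeniusDictionary

open Literature.NumberTheory.EllipticCurves Literature.NumberTheory.GaloisRepresentations Rat.HeightOneSpectrum

/-- **(D4) The Kummer congruence at a Frobenius.** `ℓ = 3k + 1` a prime `≠ 3`, `v` the place of `ℚ` at `ℓ`, `𝔓 ∈ v.primesAbove` a prime of `ℤ̄`, `σ ∈ Γ_ℚ` an
arithmetic Frobenius at `𝔓`; `x, γ, ζ ∈ ℤ̄` with `γ³ = x`, `x ∉ 𝔓`, `ζ² + ζ + 1 = 0` (a primitive cube root of unity) and `σ • γ = ζ γ` (the Frobenius moves the cube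
root). THEN `x^k − 1 ∉ 𝔓`, i.e. `x^{(ℓ−1)/3} ≢ 1 (mod 𝔓)`: `x` is not a cube modulo `𝔓`. [cite: SerreLocalFields1979, Ch. I §8] [cite: Cox2013, §5.B] -/
theorem pow_sub_one_not_mem_of_frob_smul_eq_mul {ℓ : ℕ} (hℓ : ℓ.Prime) (hℓ3 : ℓ ≠ 3)
    {v : HeightOneSpectrum (𝓞 ℚ)} (hv : (primesEquiv v : ℕ) = ℓ) {𝔓 : Ideal (absIntegers (𝓞 ℚ) ℚ)}
    (h𝔓 : 𝔓 ∈ v.primesAbove) {σ : absoluteGaloisGroup ℚ} (hσ : IsArithFrobAt (𝓞 ℚ) σ 𝔓)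
    {k : ℕ} (hk : ℓ = 3 * k + 1) {x γ ζ : absIntegers (𝓞 ℚ) ℚ} (hγ : γ ^ 3 = x) (hx : x ∉ 𝔓)
    (hζ : ζ ^ 2 + ζ + 1 = 0) (hσγ : σ • γ = ζ * γ) :
    x ^ k - 1 ∉ 𝔓 := by
  haveI : 𝔓.IsPrime := h𝔓.1
  -- `σ γ ≡ γ^ℓ = x^k γ (mod 𝔓)`
  have h1 : σ • γ - γ ^ ℓ ∈ 𝔓 := smul_sub_pow_mem_of_isArithFrobAt hv h𝔓 hσ γ
  rw [hσγ, hk, pow_succ, pow_mul, hγ, ← sub_mul] at h1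
  have hγ𝔓 : γ ∉ 𝔓 := fun h ↦ hx (by rw [← hγ]; exact 𝔓.pow_mem_of_mem h 3 (by norm_num))
  have h3 : ζ - x ^ k ∈ 𝔓 := ((Ideal.IsPrime.mem_or_mem ‹_› h1).resolve_right hγ𝔓)
  intro h4
  have h5 : ζ - 1 ∈ 𝔓 := by
    have := 𝔓.add_mem h3 h4
    rwa [sub_add_sub_cancel] at this
  -- `(ζ − 1)(ζ + 2) = −3`, so `3 ∈ 𝔓`
  have h6 : (3 : absIntegers (𝓞 ℚ) ℚ) ∈ 𝔓 := by
    have e : (ζ - 1) * (ζ + 2) = -3 := by linear_combination hζ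
    have := 𝔓.mul_mem_right (ζ + 2) h5
    rw [e] at this
    exact (Submodule.neg_mem_iff _).mp this
  -- `ℓ ∈ 𝔓`
  have hℓv : ((ℓ : ℕ) : 𝓞 ℚ) ∈ v.asIdeal :=
    (natCast_mem_asIdeal_iff_eq_primesEquiv_symm v hℓ).mpr
      ((Equiv.eq_symm_apply _).mpr (Subtype.ext hv))
  have hℓ𝔓 : ((ℓ : ℕ) : absIntegers (𝓞 ℚ) ℚ) ∈ 𝔓 := by
    have h := hℓv
    rw [h𝔓.2.over, Ideal.under_def, Ideal.mem_comap, map_natCast] at h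
    exact h
  -- `gcd(3, ℓ) = 1` ⟹ `1 ∈ 𝔓`
  have hcop : IsCoprime (3 : ℤ) (ℓ : ℤ) :=
    Nat.isCoprime_iff_coprime.mpr ((Nat.coprime_primes Nat.prime_three hℓ).mpr (Ne.symm hℓ3))
  obtain ⟨a, b, hab⟩ := hcop
  apply Ideal.IsPrime.ne_top ‹_›
  rw [Ideal.eq_top_iff_one]
  have e1 : ((a * 3 + b * ℓ : ℤ) : absIntegers (𝓞 ℚ) ℚ) = 1 := by rw [hab, Int.cast_one]
  rw [← e1]
  push_cast
  exact 𝔓.add_mem (𝔓.mul_mem_left _ h6) (𝔓.mul_mem_left _ hℓ𝔓)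

/-- **(D5) From the cube-root congruence to the conjugate-power congruence.** `ℓ = 3k + 1` prime, `𝔓 ∈ v.primesAbove`, `σ` an arithmetic Frobenius at `𝔓`;
`y, z ∈ ℤ̄` (intended: the images of `β` and of its conjugate `β̄` under an embedding `K ↪ ℚ̄` on which `σ` is TRIVIAL — `ℓ` split in `K`), with `σ • z = z`,
`z ∉ 𝔓`, and `(y z²)^k − 1 ∉ 𝔓` ((D4) for `x = y z² = β β̄²`). THEN `y^k − z^k ∉ 𝔓` — so `β^k ≢ β̄^k (mod λ)`, whence «`β^k` is not rational mod `ℓ𝒪_K`»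
(if `β^k ≡ a` then `β̄^k ≡ a` too), the hypothesis of (D3) `RingClassSplit.pow_dvd_orderOf_primeClass_of_not_rational`. Proof: `σ z ≡ z^ℓ` and `σ z = z ∉ 𝔓` give
`z^{3k} ≡ 1`; if `y^k ≡ z^k` then `(y z²)^k ≡ z^{3k} ≡ 1 (mod 𝔓)`. [cite: SerreLocalFields1979, Ch. I §8] -/
theorem pow_sub_pow_not_mem_of_frob_fixed {ℓ : ℕ} {v : HeightOneSpectrum (𝓞 ℚ)} (hv : (primesEquiv v : ℕ) = ℓ)
    {𝔓 : Ideal (absIntegers (𝓞 ℚ) ℚ)} (h𝔓 : 𝔓 ∈ v.primesAbove) {σ : absoluteGaloisGroup ℚ} (hσ : IsArithFrobAt (𝓞 ℚ) σ 𝔓)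
    {k : ℕ} (hk : ℓ = 3 * k + 1) {y z : absIntegers (𝓞 ℚ) ℚ} (hσz : σ • z = z) (hz : z ∉ 𝔓)
    (hx : (y * z ^ 2) ^ k - 1 ∉ 𝔓) :
    y ^ k - z ^ k ∉ 𝔓 := by
  haveI : 𝔓.IsPrime := h𝔓.1
  -- `z^{3k} ≡ 1 (mod 𝔓)`
  have h1 : σ • z - z ^ ℓ ∈ 𝔓 := smul_sub_pow_mem_of_isArithFrobAt hv h𝔓 hσ z
  rw [hσz, hk, pow_succ] at h1
  have h2 : (1 - z ^ (3 * k)) * z ∈ 𝔓 := by rw [sub_mul, one_mul]; exact h1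
  have h3 : 1 - z ^ (3 * k) ∈ 𝔓 := (Ideal.IsPrime.mem_or_mem ‹_› h2).resolve_right hz
  intro h4
  apply hx
  -- `(y z²)^k − 1 = (y^k − z^k) z^{2k} − (1 − z^{3k})`
  have e : (y * z ^ 2) ^ k - 1 = (y ^ k - z ^ k) * z ^ (2 * k) - (1 - z ^ (3 * k)) := by ring
  rw [e]
  exact 𝔓.sub_mem (𝔓.mul_mem_right _ h4) h3

end Summit.BirchSwinnertonDyer.BirchSwinnertonDyer.Theorems.FrobeniusDictionary

end
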